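import Mathlib.Analysis.Complex.ExponentialBounds
import Literature.Computability.Complexity.ComputableRealProofs
import Literature.Computability.Complexity.ComputableExp
import HarnessLib

/-!
# The complex exponential along computable sequences — proof

Sibling proof file of `ComputableExp.lean` (D-0014: the named fact there stays a `def`; this file
discharges it): **`uniformlyComputable_cexp_holds : uniformlyComputable_cexp`** — if `a : ℕ → ℂ`
has one computable Gaussian-rational name `f : ℕ × ℕ → ℚ × ℚ` (`‖a k − f(k,m)‖ ≤ 2⁻ᵐ`), then so
has `k ↦ exp (a k)` (Weihrauch 2000, Example 4.3.13.2 with Thm. 4.3.10 / Lemma 4.3.6).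

## The printed argument, as formalised

Weihrauch, *Computable Analysis* (2000): Example 4.3.13.2 — `exp` is computable on `ℂ`, by the
power series `∑ zʲ/j!` (Thm. 4.3.12: a power series with a computable coefficient sequence and an
effective tail bound is computable on every closed disc inside its radius of convergence) — and
Thm. 4.3.10 / Lemma 4.3.6.1 — a computable function maps computable sequences to computable
sequences, uniformly (one machine serves all indices `k`). Mathlib's `Computable` carries no time
bound, so the machine may use exact rational arithmetic; the formalisation is the textbook
evaluation (Ko 1991, §2.1–2.2 pattern; cf. `PolyTimeComputableRealsElementaryProofs.lean` for the
polynomial-time real version):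

1. *a priori bound*: from the `m = 0` approximation `q₀ = f(k,0)`, `‖a k‖ ≤ |q₀.1| + |q₀.2| + 1 ≤ B`
   with `B = CExpName.bnd q₀` a natural number read off the numerators (`CExpName.nb`,
   `CExpName.norm_le_bnd`);
2. *argument*: `q = f(k, m + 2B + 4)`, so `‖q‖ ≤ B + 1 =: D` and, by the Lipschitz estimate
   `‖exp z − exp q‖ ≤ ‖exp q‖ · 2‖z − q‖` (Mathlib `Complex.norm_exp_sub_one_le`) with
   `‖exp q‖ ≤ e^D ≤ 4^D`, `‖exp (a k) − exp q‖ ≤ 2^{−(m+1)}` (`CExpName.exp_sub_exp_le`);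
3. *range reduction and Taylor*: `x = q / D` has `‖x‖ ≤ 1`; the Taylor sum
   `w = ∑_{j<N} xʲ/j!`, `N = 3B + m + 6`, computed in exact Gaussian-rational arithmetic
   (`CExpName.taylor`, `CExpName.toC_taylor`), satisfies `‖exp x − w‖ ≤ 4 / 2^N`
   (Mathlib `Complex.exp_bound`, `CExpName.taylorCoeff_le`);
4. *powering*: `exp q = (exp x)^D` (`Complex.exp_nat_mul`) and
   `‖uᴰ − wᴰ‖ ≤ D · 4ᴰ · ‖u − w‖` for `‖u‖, ‖w‖ ≤ 4` (`CExpName.norm_pow_sub_pow_le`), so the output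
   `wᴰ` (`CExpName.gpow`) is within `2^{−(m+1)}` of `exp q`; total error `≤ 2⁻ᵐ`
   (`CExpName.approx_spec`);
5. *computability*: all arithmetic is primitive recursive for Mathlib's `Primcodable ℚ`
   (`rat_add_primrec`, `rat_mul_primrec`, `rat_sub_primrec`, `primrec_mkRat_natSub` of
   `ComputableRealProofs.lean`; division by a positive natural `CExpName.rat_divSucc_primrec`;
   iterations by `Primrec.nat_iterate`), and the name `CExpName.name f` queries `f` twice, so it is
   `Computable` when `f` is (`CExpName.computable_name`).

Everything here is proved; no named fact is introduced. The helper `def`s (`CExpName.*`) are the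
explicit rational algorithm (plumbing of the proof, not mathematical objects of the literature).

## References

* K. Weihrauch, *Computable Analysis. An Introduction*, Springer 2000: Example 4.3.13.2, Thm. 4.3.12,
  Thm. 4.3.10, Lemma 4.3.6, Def. 4.1.5 / Lemma 4.1.6 [WeihrauchComputableAnalysis2000].
* K.-I. Ko, *Complexity Theory of Real Functions*, Birkhäuser 1991, §2.1–2.2 [Ko1991].
-/

noncomputable section

namespace Literature.Computability.Complexity

open Complex Finset

namespace CExpName

/-! ### Gaussian-rational arithmetic -/

/-- The complex number `u + v i` named by the Gaussian rational `(u, v)` (the convention of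
`uniformlyComputable_cexp`). [cite: WeihrauchComputableAnalysis2000, Def. 4.1.5] -/
def toC (p : ℚ × ℚ) : ℂ := (p.1 : ℂ) + (p.2 : ℂ) * I

/-- Sum of Gaussian rationals. [folklore] -/
def gadd (p q : ℚ × ℚ) : ℚ × ℚ := (p.1 + q.1, p.2 + q.2)

/-- Product of Gaussian rationals. [folklore] -/
def gmul (p q : ℚ × ℚ) : ℚ × ℚ := (p.1 * q.1 - p.2 * q.2, p.1 * q.2 + p.2 * q.1)

/-- Division of a Gaussian rational by the positive natural number `n + 1`. [folklore] -/
def gdivSucc (p : ℚ × ℚ) (n : ℕ) : ℚ × ℚ := (p.1 / ((n : ℚ) + 1), p.2 / ((n : ℚ) + 1))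

/-- `toC` is additive. [folklore] -/
private theorem toC_gadd (p q : ℚ × ℚ) : toC (gadd p q) = toC p + toC q := by
  simp only [toC, gadd]
  push_cast
  ring

/-- `toC` is multiplicative. [folklore] -/
private theorem toC_gmul (p q : ℚ × ℚ) : toC (gmul p q) = toC p * toC q := by
  simp only [toC, gmul]
  push_cast
  have hI : I * I = -1 := I_mul_I
  linear_combination (-(p.2 : ℂ) * (q.2 : ℂ)) * hI

/-- `toC` commutes with division by `n + 1`. [folklore] -/
private theorem toC_gdivSucc (p : ℚ × ℚ) (n : ℕ) : toC (gdivSucc p n) = toC p / ((n : ℂ) + 1) := by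
  simp only [toC, gdivSucc]
  push_cast
  ring

/-- `toC (1, 0) = 1`. [folklore] -/
@[simp] private theorem toC_one : toC (1, 0) = 1 := by simp [toC]

/-- `toC (0, 0) = 0`. [folklore] -/
@[simp] private theorem toC_zero : toC (0, 0) = 0 := by simp [toC]

/-- The norm of `u + v i` is at most `|u| + |v|`. [folklore] -/
private theorem norm_toC_le (p : ℚ × ℚ) : ‖toC p‖ ≤ |(p.1 : ℝ)| + |(p.2 : ℝ)| := by
  refine (norm_le_abs_re_add_abs_im _).trans (le_of_eq ?_)
  simp [toC]

/-! ### The Taylor sum and powers, in exact arithmetic -/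

/-- One step of the Taylor recursion `(j, xʲ/j!, ∑_{i<j} xⁱ/i!) ↦ (j+1, xʲ⁺¹/(j+1)!, ∑_{i≤j} xⁱ/i!)`.
[cite: WeihrauchComputableAnalysis2000, Thm. 4.3.12] -/
def tstep (x : ℚ × ℚ) (s : ℕ × (ℚ × ℚ) × (ℚ × ℚ)) : ℕ × (ℚ × ℚ) × (ℚ × ℚ) :=
  (s.1 + 1, gdivSucc (gmul s.2.1 x) s.1, gadd s.2.2 s.2.1)

/-- The Taylor sum `∑_{j<N} xʲ/j!` of `exp` at the Gaussian rational `x`, as a Gaussian rational.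
[cite: WeihrauchComputableAnalysis2000, Example 4.3.13.2] -/
def taylor (x : ℚ × ℚ) (N : ℕ) : ℚ × ℚ := ((tstep x)^[N] (0, (1, 0), (0, 0))).2.2

/-- Invariant of the Taylor recursion after `n` steps. [cite: WeihrauchComputableAnalysis2000, Thm. 4.3.12] -/
theorem iterate_tstep (x : ℚ × ℚ) : ∀ n : ℕ,
    ((tstep x)^[n] (0, (1, 0), (0, 0))).1 = n ∧
      toC ((tstep x)^[n] (0, (1, 0), (0, 0))).2.1 = toC x ^ n / (n.factorial : ℂ) ∧
      toC ((tstep x)^[n] (0, (1, 0), (0, 0))).2.2 = ∑ j ∈ range n, toC x ^ j / (j.factorial : ℂ)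
  | 0 => by simp
  | n + 1 => by
    obtain ⟨h1, h2, h3⟩ := iterate_tstep x n
    rw [Function.iterate_succ_apply']
    refine ⟨by rw [tstep, h1], ?_, ?_⟩
    · change toC (gdivSucc (gmul ((tstep x)^[n] (0, (1, 0), (0, 0))).2.1 x)
        ((tstep x)^[n] (0, (1, 0), (0, 0))).1) = _
      rw [toC_gdivSucc, toC_gmul, h2, h1, Nat.factorial_succ]
      have hn : ((n : ℂ) + 1) ≠ 0 := by exact_mod_cast Nat.succ_ne_zero n
      have hf : ((n.factorial : ℕ) : ℂ) ≠ 0 := by exact_mod_cast (Nat.factorial_pos n).ne'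
      push_cast
      field_simp
      ring
    · change toC (gadd ((tstep x)^[n] (0, (1, 0), (0, 0))).2.2 ((tstep x)^[n] (0, (1, 0), (0, 0))).2.1) = _
      rw [toC_gadd, h3, h2, Finset.sum_range_succ]

/-- The computed Taylor sum is the Taylor sum. [cite: WeihrauchComputableAnalysis2000, Example 4.3.13.2] -/
theorem toC_taylor (x : ℚ × ℚ) (N : ℕ) :
    toC (taylor x N) = ∑ j ∈ range N, toC x ^ j / (j.factorial : ℂ) :=
  (iterate_tstep x N).2.2

/-- The power `wᴹ` of a Gaussian rational, by iterated multiplication. [folklore] -/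
def gpow (w : ℚ × ℚ) (M : ℕ) : ℚ × ℚ := (gmul w)^[M] (1, 0)

/-- The computed power is the power. [folklore] -/
private theorem toC_gpow (w : ℚ × ℚ) : ∀ M : ℕ, toC (gpow w M) = toC w ^ M
  | 0 => by simp [gpow]
  | M + 1 => by
    change toC ((gmul w)^[M + 1] (1, 0)) = _
    rw [Function.iterate_succ_apply', toC_gmul, ← gpow, toC_gpow w M, pow_succ']

/-! ### The a priori bound -/

/-- A natural number bounding `|q|`: the absolute value of the numerator,
`q.num⁺ + q.num⁻ = |q.num| ≥ |q|`. [folklore] -/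
def nb (q : ℚ) : ℕ := q.num.toNat + (-q.num).toNat

/-- `|q| ≤ nb q`. [folklore] -/
private theorem abs_cast_le_nb (q : ℚ) : |(q : ℝ)| ≤ (nb q : ℝ) := by
  rw [nb, Int.toNat_add_toNat_neg_eq_natAbs, Nat.cast_natAbs, Int.cast_abs, Rat.cast_def, abs_div,
    Nat.abs_cast]
  exact div_le_self (abs_nonneg _) (by exact_mod_cast q.den_pos)

/-- The bound `B(q₀) = nb q₀.1 + nb q₀.2 + 1 ≥ ‖q₀‖ + 1` attached to the first approximation.
[cite: WeihrauchComputableAnalysis2000, Thm. 4.3.12] -/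
def bnd (q₀ : ℚ × ℚ) : ℕ := nb q₀.1 + nb q₀.2 + 1

/-- `‖q₀‖ + 1 ≤ B(q₀)`. [folklore] -/
private theorem norm_le_bnd (q₀ : ℚ × ℚ) : ‖toC q₀‖ + 1 ≤ (bnd q₀ : ℝ) := by
  have h := norm_toC_le q₀
  have h1 := abs_cast_le_nb q₀.1
  have h2 := abs_cast_le_nb q₀.2
  simp only [bnd, Nat.cast_add, Nat.cast_one]
  linarith

/-! ### The approximant -/

/-- The output Gaussian rational at precision `m`, from the first approximation `q₀ = f(k,0)`
(which fixes `B = bnd q₀`) and the fine approximation `q = f(k, m + 2B + 4)`: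
`(∑_{j<3B+m+6} xʲ/j!)^{B+1}` with `x = q/(B+1)`. [cite: WeihrauchComputableAnalysis2000, Example 4.3.13.2] -/
def approx (m : ℕ) (q₀ q : ℚ × ℚ) : ℚ × ℚ :=
  gpow (taylor (gdivSucc q (bnd q₀)) (3 * bnd q₀ + m + 6)) (bnd q₀ + 1)

/-- The name of `k ↦ exp (a k)` built from a name `f` of `a`: two queries to `f`.
[cite: WeihrauchComputableAnalysis2000, Thm. 4.3.10] -/
def name (f : ℕ × ℕ → ℚ × ℚ) (p : ℕ × ℕ) : ℚ × ℚ :=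
  approx p.2 (f (p.1, 0)) (f (p.1, p.2 + 2 * bnd (f (p.1, 0)) + 4))

/-! ### Error analysis -/

/-- `‖aⁿ − bⁿ‖ ≤ n Rⁿ ‖a − b‖` for `‖a‖, ‖b‖ ≤ R`, `1 ≤ R`. [folklore] -/
private theorem norm_pow_sub_pow_le {a b : ℂ} {R : ℝ} (hR : 1 ≤ R) (ha : ‖a‖ ≤ R) (hb : ‖b‖ ≤ R) :
    ∀ n : ℕ, ‖a ^ n - b ^ n‖ ≤ n * R ^ n * ‖a - b‖
  | 0 => by simp
  | n + 1 => by
    have ih := norm_pow_sub_pow_le hR ha hb n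
    have hR0 : 0 ≤ R := zero_le_one.trans hR
    have hsplit : a ^ (n + 1) - b ^ (n + 1) = a * (a ^ n - b ^ n) + (a - b) * b ^ n := by ring
    rw [hsplit]
    have hbn : ‖b ^ n‖ ≤ R ^ n := by rw [norm_pow]; exact pow_le_pow_left₀ (norm_nonneg _) hb n
    calc ‖a * (a ^ n - b ^ n) + (a - b) * b ^ n‖
        ≤ ‖a‖ * ‖a ^ n - b ^ n‖ + ‖a - b‖ * ‖b ^ n‖ := by
          refine (norm_add_le _ _).trans ?_
          rw [norm_mul, norm_mul]
      _ ≤ R * (n * R ^ n * ‖a - b‖) + ‖a - b‖ * R ^ n := by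
          gcongr
      _ = (n * R + 1) * R ^ n * ‖a - b‖ := by ring
      _ ≤ ((n + 1 : ℕ) : ℝ) * R ^ (n + 1) * ‖a - b‖ := by
          have h1 : (n * R + 1) * R ^ n ≤ ((n + 1 : ℕ) : ℝ) * R ^ (n + 1) := by
            rw [pow_succ, Nat.cast_succ]
            have : (n * R + 1) ≤ (n + 1) * R := by nlinarith
            calc (n * R + 1) * R ^ n ≤ ((n + 1) * R) * R ^ n := by gcongr
              _ = (n + 1) * (R ^ n * R) := by ring
          exact mul_le_mul_of_nonneg_right h1 (norm_nonneg _)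

/-- `2ᴺ ≤ 2 · N!`. [folklore] -/
private theorem two_pow_le_two_mul_factorial : ∀ N : ℕ, 2 ^ N ≤ 2 * N.factorial
  | 0 => by simp
  | 1 => by simp
  | N + 2 => by
    have ih := two_pow_le_two_mul_factorial (N + 1)
    rw [pow_succ, Nat.factorial_succ (N + 1)]
    nlinarith

/-- The Taylor coefficient bound of `Complex.exp_bound` is at most `4 / 2ᴺ` (`N ≥ 1`):
`(N+1)/(N!·N) ≤ 2/N! ≤ 4/2ᴺ`. [folklore] -/
private theorem taylorCoeff_le {N : ℕ} (hN : 0 < N) :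
    ((N.succ : ℝ) * ((N.factorial : ℝ) * N)⁻¹) ≤ 4 / 2 ^ N := by
  have hf : (0 : ℝ) < N.factorial := by exact_mod_cast Nat.factorial_pos N
  have hNr : (0 : ℝ) < N := by exact_mod_cast hN
  have h2 : ((2 ^ N : ℕ) : ℝ) ≤ 2 * N.factorial := by exact_mod_cast two_pow_le_two_mul_factorial N
  push_cast at h2
  rw [← div_eq_mul_inv, div_le_div_iff₀ (mul_pos hf hNr) (pow_pos two_pos N), Nat.cast_succ]
  have h1 : (1 : ℝ) ≤ N := by exact_mod_cast hN
  nlinarith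

/-- `e ≤ 4`, hence `exp D ≤ 4ᴰ` for a natural number `D`. [folklore] -/
private theorem exp_nat_le_four_pow (D : ℕ) : Real.exp D ≤ (4 : ℝ) ^ D := by
  have h1 : Real.exp 1 ≤ 4 := by
    have := Real.exp_one_lt_d9
    linarith
  calc Real.exp D = Real.exp 1 ^ D := by rw [← Real.exp_nat_mul, mul_one]
    _ ≤ 4 ^ D := pow_le_pow_left₀ (Real.exp_pos 1).le h1 D

/-- The exponent bookkeeping of the powering step: `2ᴰ · 4ᴰ · (4 / 2^{3D+m+3}) = 2^{−(m+1)}`.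
[folklore] -/
private theorem two_pow_budget (D m : ℕ) :
    (2 : ℝ) ^ D * 4 ^ D * (4 / 2 ^ (3 * D + m + 3)) = 1 / 2 ^ (m + 1) := by
  rw [show (4 : ℝ) = 2 ^ 2 by norm_num, ← pow_mul,
    show 3 * D + m + 3 = (m + 1) + (D + 2 * D + 2) by ring, pow_add (2 : ℝ) (m + 1), pow_add,
    pow_add]
  have h2 : (2 : ℝ) ^ (m + 1) ≠ 0 := pow_ne_zero _ two_ne_zero
  have hD : (2 : ℝ) ^ D ≠ 0 := pow_ne_zero _ two_ne_zero
  have h2D : (2 : ℝ) ^ (2 * D) ≠ 0 := pow_ne_zero _ two_ne_zero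
  field_simp
  rw [← pow_add]

/-- Lipschitz step: if `‖q‖ ≤ D` and `‖z − q‖ ≤ 2^{−(m + 2D + 2)}` then
`‖exp z − exp q‖ ≤ 2^{−(m+1)}`. [cite: WeihrauchComputableAnalysis2000, Thm. 4.3.12] -/
theorem exp_sub_exp_le {z q : ℂ} {D m : ℕ} (hq : ‖q‖ ≤ D)
    (hzq : ‖z - q‖ ≤ 1 / 2 ^ (m + 2 * D + 2)) :
    ‖cexp z - cexp q‖ ≤ 1 / 2 ^ (m + 1) := by
  have hzq1 : ‖z - q‖ ≤ 1 := hzq.trans (by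
    rw [div_le_one (pow_pos two_pos _)]
    exact one_le_pow₀ (by norm_num))
  have hfac : cexp z - cexp q = cexp q * (cexp (z - q) - 1) := by
    rw [mul_sub, mul_one, ← Complex.exp_add, add_sub_cancel]
  have hexpq : ‖cexp q‖ ≤ (2 : ℝ) ^ (2 * D) := by
    refine (norm_exp_le_exp_norm q).trans ?_
    refine (Real.exp_le_exp.2 hq).trans ?_
    refine (exp_nat_le_four_pow D).trans (le_of_eq ?_)
    rw [pow_mul]
    norm_num
  rw [hfac, norm_mul]
  calc ‖cexp q‖ * ‖cexp (z - q) - 1‖ ≤ (2 : ℝ) ^ (2 * D) * (2 * ‖z - q‖) := by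
        gcongr
        exact norm_exp_sub_one_le hzq1
    _ ≤ (2 : ℝ) ^ (2 * D) * (2 * (1 / 2 ^ (m + 2 * D + 2))) := by gcongr
    _ = 1 / 2 ^ (m + 1) := by
        have h : (2 : ℝ) ^ (m + 2 * D + 2) = 2 ^ (m + 1) * (2 ^ (2 * D) * 2) := by
          rw [← pow_succ, ← pow_add]; ring_nf
        rw [h]
        field_simp

/-- **The approximant is `2⁻ᵐ`-close.** If `‖z − q₀‖ ≤ 1` and `‖z − q‖ ≤ 2^{−(m + 2B + 4)}` with
`B = bnd q₀`, then `‖exp z − approx m q₀ q‖ ≤ 2⁻ᵐ`. [cite: WeihrauchComputableAnalysis2000, Example 4.3.13.2] -/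
theorem approx_spec {z : ℂ} {m : ℕ} {q₀ q : ℚ × ℚ} (h0 : ‖z - toC q₀‖ ≤ 1)
    (hq : ‖z - toC q‖ ≤ 1 / 2 ^ (m + 2 * bnd q₀ + 4)) :
    ‖cexp z - toC (approx m q₀ q)‖ ≤ 1 / 2 ^ m := by
  set B := bnd q₀ with hB
  set D := B + 1 with hD
  set N := 3 * B + m + 6 with hN
  set x := gdivSucc q B with hx
  -- a priori bounds
  have hzB : ‖z‖ ≤ B := by
    have h1 : ‖z‖ ≤ ‖z - toC q₀‖ + ‖toC q₀‖ := by
      have := norm_add_le (z - toC q₀) (toC q₀)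
      rwa [sub_add_cancel] at this
    have h2 := norm_le_bnd q₀
    linarith
  have hq1 : ‖z - toC q‖ ≤ 1 := hq.trans (by
    rw [div_le_one (pow_pos two_pos _)]
    exact one_le_pow₀ (by norm_num))
  have hqD : ‖toC q‖ ≤ D := by
    have h1 : ‖toC q‖ ≤ ‖toC q - z‖ + ‖z‖ := by
      have := norm_add_le (toC q - z) z
      rwa [sub_add_cancel] at this
    rw [norm_sub_rev] at h1
    simp only [hD, Nat.cast_add, Nat.cast_one]
    linarith
  have hDpos : (0 : ℝ) < D := by positivity
  have hDC : ((B : ℂ) + 1) = (D : ℂ) := by simp [hD]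
  have hxq : toC x = toC q / (D : ℂ) := by rw [hx, toC_gdivSucc, hDC]
  have hx1 : ‖toC x‖ ≤ 1 := by
    rw [hxq, norm_div, Complex.norm_natCast, div_le_one hDpos]
    exact hqD
  -- Lipschitz part
  have hE1 : ‖cexp z - cexp (toC q)‖ ≤ 1 / 2 ^ (m + 1) := by
    refine exp_sub_exp_le (D := D) hqD ?_
    have : m + 2 * D + 2 = m + 2 * B + 4 := by rw [hD]; ring
    rw [this]
    exact hq
  -- Taylor part
  set u := cexp (toC x) with hu
  set w := toC (taylor x N) with hw
  have hNpos : 0 < N := by rw [hN]; omega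
  have hε : ‖u - w‖ ≤ 4 / 2 ^ N := by
    rw [hu, hw, toC_taylor]
    refine (Complex.exp_bound hx1 hNpos).trans ?_
    calc ‖toC x‖ ^ N * ((N.succ : ℝ) * ((N.factorial : ℝ) * N)⁻¹)
        ≤ 1 * (4 / 2 ^ N) :=
          mul_le_mul (pow_le_one₀ (norm_nonneg _) hx1) (taylorCoeff_le hNpos) (by positivity) zero_le_one
      _ = 4 / 2 ^ N := one_mul _
  have hε1 : ‖u - w‖ ≤ 1 := hε.trans (by
    rw [div_le_one (pow_pos two_pos _)]
    calc (4 : ℝ) = 2 ^ 2 := by norm_num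
      _ ≤ 2 ^ N := pow_le_pow_right₀ (by norm_num) (by omega))
  have hu3 : ‖u‖ ≤ 3 := by
    rw [hu]
    refine (norm_exp_le_exp_norm _).trans ((Real.exp_le_exp.2 hx1).trans ?_)
    have := Real.exp_one_lt_d9
    linarith
  have hw4 : ‖w‖ ≤ 4 := by
    have h1 : ‖w‖ ≤ ‖w - u‖ + ‖u‖ := by
      have := norm_add_le (w - u) u
      rwa [sub_add_cancel] at this
    rw [norm_sub_rev] at h1
    linarith
  have hu4 : ‖u‖ ≤ 4 := hu3.trans (by norm_num)
  -- powering
  have hexpq : cexp (toC q) = u ^ D := by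
    rw [hu, ← Complex.exp_nat_mul, hxq, mul_div_cancel₀]
    exact_mod_cast hDpos.ne'
  have happrox : toC (approx m q₀ q) = w ^ D := by
    rw [approx, toC_gpow, ← hB, ← hx, ← hN, ← hw]
  have hE2 : ‖cexp (toC q) - toC (approx m q₀ q)‖ ≤ 1 / 2 ^ (m + 1) := by
    rw [hexpq, happrox]
    refine (norm_pow_sub_pow_le (R := 4) (by norm_num) hu4 hw4 D).trans ?_
    have hD2 : (D : ℝ) ≤ 2 ^ D := by exact_mod_cast (Nat.lt_two_pow_self).le
    calc (D : ℝ) * 4 ^ D * ‖u - w‖ ≤ 2 ^ D * 4 ^ D * (4 / 2 ^ N) := by gcongr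
      _ = 1 / 2 ^ (m + 1) := by
          rw [show N = 3 * D + m + 3 by omega]
          exact two_pow_budget D m
  -- total
  calc ‖cexp z - toC (approx m q₀ q)‖
      ≤ ‖cexp z - cexp (toC q)‖ + ‖cexp (toC q) - toC (approx m q₀ q)‖ := norm_sub_le_norm_sub_add_norm_sub _ _ _
    _ ≤ 1 / 2 ^ (m + 1) + 1 / 2 ^ (m + 1) := add_le_add hE1 hE2
    _ = 1 / 2 ^ m := by rw [pow_succ]; field_simp; norm_num

/-! ### Computability -/

/-- Division of a rational by a positive natural, `(q, n) ↦ q / (n + 1)`, is primitive recursive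
(for Mathlib's `Primcodable ℚ`): `q / (n+1) = mkRat (q.num⁺ − q.num⁻) (q.den (n+1))`.
[folklore] -/
private theorem rat_divSucc_primrec : Primrec₂ (fun (q : ℚ) (n : ℕ) => q / ((n : ℚ) + 1)) := by
  have h : Primrec (fun p : ℚ × ℕ =>
      mkRat ((p.1.num.toNat : ℤ) - ((-p.1.num).toNat : ℕ)) ((p.1.den * (p.2 + 1) - 1) + 1)) :=
    primrec_mkRat_natSub.comp (Primrec.pair (rat_numToNat_primrec.comp Primrec.fst)
      (Primrec.pair (rat_negNumToNat_primrec.comp Primrec.fst)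
        (Primrec.pred.comp (Primrec.nat_mul.comp (rat_den_primrec.comp Primrec.fst)
          (Primrec.succ.comp Primrec.snd)))))
  refine Primrec₂.mk (h.of_eq fun p => ?_)
  have hd : 1 ≤ p.1.den * (p.2 + 1) := Nat.one_le_iff_ne_zero.2 (Nat.mul_ne_zero p.1.den_nz (Nat.succ_ne_zero _))
  rw [Int.toNat_sub_toNat_neg, Nat.sub_add_cancel hd, Rat.mkRat_eq_div]
  conv_rhs => rw [← Rat.num_div_den p.1]
  push_cast
  rw [div_div]

/-- `gadd` is primitive recursive. [folklore] -/
private theorem primrec_gadd : Primrec₂ gadd := by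
  unfold gadd
  exact Primrec₂.mk (Primrec.pair
    (rat_add_primrec.comp (Primrec.fst.comp Primrec.fst) (Primrec.fst.comp Primrec.snd))
    (rat_add_primrec.comp (Primrec.snd.comp Primrec.fst) (Primrec.snd.comp Primrec.snd)))

/-- `gmul` is primitive recursive. [folklore] -/
private theorem primrec_gmul : Primrec₂ gmul := by
  unfold gmul
  exact Primrec₂.mk (Primrec.pair
    (rat_sub_primrec.comp
      (rat_mul_primrec.comp (Primrec.fst.comp Primrec.fst) (Primrec.fst.comp Primrec.snd))
      (rat_mul_primrec.comp (Primrec.snd.comp Primrec.fst) (Primrec.snd.comp Primrec.snd)))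
    (rat_add_primrec.comp
      (rat_mul_primrec.comp (Primrec.fst.comp Primrec.fst) (Primrec.snd.comp Primrec.snd))
      (rat_mul_primrec.comp (Primrec.snd.comp Primrec.fst) (Primrec.fst.comp Primrec.snd))))

/-- `gdivSucc` is primitive recursive. [folklore] -/
private theorem primrec_gdivSucc : Primrec₂ gdivSucc := by
  unfold gdivSucc
  exact Primrec₂.mk (Primrec.pair
    (rat_divSucc_primrec.comp (Primrec.fst.comp Primrec.fst) Primrec.snd)
    (rat_divSucc_primrec.comp (Primrec.snd.comp Primrec.fst) Primrec.snd))

/-- The Taylor step is primitive recursive in `(x, state)`. [folklore] -/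
private theorem primrec_tstep : Primrec₂ tstep := by
  unfold tstep
  refine Primrec₂.mk (Primrec.pair (Primrec.succ.comp (Primrec.fst.comp Primrec.snd))
    (Primrec.pair ?_ ?_))
  · exact primrec_gdivSucc.comp
      (primrec_gmul.comp (Primrec.fst.comp (Primrec.snd.comp Primrec.snd)) Primrec.fst)
      (Primrec.fst.comp Primrec.snd)
  · exact primrec_gadd.comp (Primrec.snd.comp (Primrec.snd.comp Primrec.snd))
      (Primrec.fst.comp (Primrec.snd.comp Primrec.snd))

/-- The Taylor sum is primitive recursive in `(x, N)`. [folklore] -/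
private theorem primrec_taylor : Primrec₂ taylor := by
  unfold taylor
  refine Primrec₂.mk (Primrec.snd.comp (Primrec.snd.comp ?_))
  exact Primrec.nat_iterate Primrec.snd (Primrec.const _) (primrec_tstep.comp (Primrec.fst.comp Primrec.fst) Primrec.snd)

/-- The power is primitive recursive in `(w, M)`. [folklore] -/
private theorem primrec_gpow : Primrec₂ gpow := by
  unfold gpow
  refine Primrec₂.mk ?_
  exact Primrec.nat_iterate Primrec.snd (Primrec.const _) (primrec_gmul.comp (Primrec.fst.comp Primrec.fst) Primrec.snd)

/-- `nb` is primitive recursive. [folklore] -/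
private theorem primrec_nb : Primrec nb := by
  unfold nb
  exact Primrec.nat_add.comp rat_numToNat_primrec rat_negNumToNat_primrec

/-- `bnd` is primitive recursive. [folklore] -/
private theorem primrec_bnd : Primrec bnd := by
  unfold bnd
  exact Primrec.succ.comp (Primrec.nat_add.comp (primrec_nb.comp Primrec.fst) (primrec_nb.comp Primrec.snd))

/-- The approximant is primitive recursive in `(m, q₀, q)`. [folklore] -/
private theorem primrec_approx : Primrec (fun p : ℕ × (ℚ × ℚ) × (ℚ × ℚ) => approx p.1 p.2.1 p.2.2) := by
  unfold approx
  have hB : Primrec (fun p : ℕ × (ℚ × ℚ) × (ℚ × ℚ) => bnd p.2.1) := primrec_bnd.comp (Primrec.fst.comp Primrec.snd)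
  refine primrec_gpow.comp ?_ (Primrec.succ.comp hB)
  refine primrec_taylor.comp (primrec_gdivSucc.comp (Primrec.snd.comp Primrec.snd) hB) ?_
  exact Primrec.nat_add.comp (Primrec.nat_add.comp
    (Primrec.nat_mul.comp (Primrec.const 3) hB) Primrec.fst) (Primrec.const 6)

/-- **The name is computable when `f` is** (two oracle calls to `f` and primitive recursive
post-processing). [cite: WeihrauchComputableAnalysis2000, Thm. 4.3.10] -/
theorem computable_name {f : ℕ × ℕ → ℚ × ℚ} (hf : Computable f) : Computable (name f) := by
  unfold name
  have h0 : Computable (fun p : ℕ × ℕ => f (p.1, 0)) :=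
    hf.comp (Computable.pair Computable.fst (Computable.const 0))
  have hB : Computable (fun p : ℕ × ℕ => bnd (f (p.1, 0))) := primrec_bnd.to_comp.comp h0
  have hidx : Computable (fun p : ℕ × ℕ => p.2 + 2 * bnd (f (p.1, 0)) + 4) :=
    (Primrec.nat_add.to_comp.comp
      (Primrec.nat_add.to_comp.comp Computable.snd
        (Primrec.nat_mul.to_comp.comp (Computable.const 2) hB))
      (Computable.const 4))
  have hq : Computable (fun p : ℕ × ℕ => f (p.1, p.2 + 2 * bnd (f (p.1, 0)) + 4)) :=
    hf.comp (Computable.pair Computable.fst hidx)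
  have hG := primrec_approx.to_comp.comp (Computable.pair Computable.snd (Computable.pair h0 hq))
  exact hG.of_eq fun p => rfl

end CExpName

/-! ### The discharge -/

/-- **Discharge of `uniformlyComputable_cexp`** (Weihrauch 2000, Example 4.3.13.2 with
Thm. 4.3.10 / Lemma 4.3.6.1): from a computable Gaussian-rational name `f` of the sequence `a`,
`CExpName.name f` — a priori bound from `f(k,0)`, fine query `f(k, m + 2B + 4)`, Taylor sum of
`exp` at `q/(B+1)` in exact rational arithmetic, `(B+1)`-st power — is a computable name of
`k ↦ exp (a k)` with the same error `2⁻ᵐ` (`CExpName.approx_spec`, `CExpName.computable_name`).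
[cite: WeihrauchComputableAnalysis2000, Example 4.3.13.2] -/
theorem uniformlyComputable_cexp_holds : uniformlyComputable_cexp := by
  intro a hf
  obtain ⟨f, hf, hfa⟩ := hf
  refine ⟨CExpName.name f, CExpName.computable_name hf, fun k m => ?_⟩
  have h0 : ‖a k - CExpName.toC (f (k, 0))‖ ≤ 1 := by
    have := hfa k 0
    rw [pow_zero, div_one] at this
    exact this
  exact CExpName.approx_spec h0 (hfa k (m + 2 * CExpName.bnd (f (k, 0)) + 4))

end Literature.Computability.Complexity
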